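import Summits.Ventures.CertifiedArithmetic.LowPrec.OptTreePolyFormats
import Summits.Ventures.CertifiedArithmetic.LowPrec.DoubleRoundingProductStrip
import Summits.Ventures.CertifiedArithmetic.LowPrec.Monotone

/-!
# A signed nine-term family beating the tree-polynomial law in every format (OPTIMA T4(e))

HONEST FRAMING (venture CertifiedArithmetic / cell `pub-lowprec`): certified error envelopes and
provably optimal rounding/accumulation schemes for low-precision formats under stated cost models;
every table by two implementations; no hardware or vendor claims.

`OptTreePoly` / `OptTreePolyFormats` (OPTIMA.md Theorem T4): for NONNEGATIVE data every summation
tree `t` under-estimates by at most `1 - 1/M_t(u)` (`M(leaf) = 1`, `M(node) = max + u·min`),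
attained under ties-to-even.  OPTIMA.md T4(e) conjectured the same constant for SIGNED data
("Conjecture S": `|ŝ - s| ≤ (1 - 1/M_t(u))·Σ|xᵢ|` whenever `(n-1)u ≤ 1/2`).  This file builds the
counterexample family; `OptTreePolySignedRefutation.lean` draws the conclusions.

THE FAMILY.  `M = 2^m` (so `u = 1/(2M)`), `q` = one quantum of the format; nine data
`x = (-4M², -(2M+2), -2M, -4M², -(2M+2), 2M-1, 4M, 4M, 4M)·q` on the shape
`τ₉ = ((((((·,·),·),((·,·),·)),·),·),·)` (`signedTree9`; `M_τ₉(u) = 1 + 6u + 2u²`).  Under the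
format's round-to-nearest-even (`flα`): block 1 `-(4M²+2M+2)q ↦ -(4M²+4M)q` (just above the
midpoint `4M²+2M`), then `-(4M²+6M)q ↦ -(4M²+8M)q` — a TIE whose lower neighbour `(M+1)·4M` has
the ODD significand `M+1`, resolved upward (`toRat_roundNE_gmid_odd`, the odd companion of
`DoubleRoundingProductStrip.toRat_roundNE_gmid`); block 2 `↦ -(4M²+4M)q` twice; the junction
`-(8M²+12M)q` is again an odd-below tie `↦ -(8M²+16M)q`; and each tail term `+4Mq` returns the
accumulator to that same tie: `ŝ = -(8M²+16M)q` (`eval_signedTree9`), with every leaf a value of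
the format and every node in range as soon as `8M²+16M ≤ maxScaled` (`treeInRange_signedTree9`),
while `s = -(8M²-8M+5)q` and `Σ|xᵢ| = (8M²+20M+3)q` (`exact_signedTree9`, `absLeafSum_signedTree9`).
-/

namespace Summit.Ventures.CertifiedArithmetic

open Literature.ComputerArithmetic.FloatingPoint
open Literature.ComputerArithmetic.FloatingPoint.Format
open Literature.ComputerArithmetic.FloatingPoint.MiniFloat

/-! ## §1 The tie with an odd lower neighbour rounds up -/

/-- THE MIDPOINT GOES TO THE EVEN SIDE, odd case: `fl_φ ((2t+1)·2^k) = (t+1)·2^(k+1)` quanta for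
`t` ODD, `2^(P-1) ≤ t < 2^P` (a tie; the lower neighbour `t·2^(k+1)` has the odd significand `t`).
Companion of `toRat_roundNE_gmid` (even `t`). [folklore] -/
theorem toRat_roundNE_gmid_odd {φ : Format} (h1 : 1 ≤ φ.manBits) {t k : ℕ} (ht : Odd t)
    (htlo : 2 ^ φ.manBits ≤ t) (hthi : t < 2 ^ (φ.manBits + 1))
    (hu : (t + 1) * 2 ^ (k + 1) ≤ φ.maxScaled) :
    (roundNE φ ((((2 * t + 1) * 2 ^ k : ℕ) : ℚ) * φ.quantum)).toRat
      = (((t + 1) * 2 ^ (k + 1) : ℕ) : ℚ) * φ.quantum := by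
  have hq := φ.quantum_pos
  obtain ⟨hr0, hru⟩ := representable_gmid hthi hu
  obtain ⟨v0, hv0⟩ := exists_toRat_eq_natMul hr0
  obtain ⟨yu, hyu⟩ := exists_toRat_eq_natMul hru
  set x := (((2 * t + 1) * 2 ^ k : ℕ) : ℚ) * φ.quantum with hx
  set T := (2 : ℚ) ^ k * φ.quantum with hT
  have hT0 : 0 < T := by positivity
  have exv : x - v0.toRat = T := by rw [hx, hv0]; push_cast; ring
  have exu : x - yu.toRat = -T := by rw [hx, hyu]; push_cast; ring
  have hnear := roundNE_nearest (φ := φ) x yu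
  rw [exu, abs_neg, abs_of_pos hT0] at hnear
  have hor : (roundNE φ x).toRat = v0.toRat ∨ (roundNE φ x).toRat = yu.toRat := by
    rcases gap_gmid htlo hv0 (roundNE φ x) with h | h
    · rw [← hv0] at h
      left
      rw [abs_of_nonneg (by linarith)] at hnear
      linarith
    · rw [← hyu] at h
      right
      rw [abs_of_nonpos (by linarith)] at hnear
      linarith
  rcases hor with h | h
  · exfalso
    have hev : 2 ∣ (roundNE φ x).man :=
      roundNE_man_even_of_tie h1 (y := yu) (by rw [h, exv, exu, abs_neg])
        (by rw [h]; intro heq; linarith)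
    rw [two_dvd_man_iff h1] at hev
    have hS : (roundNE φ x).scaledMag = t * 2 ^ (k + 1) :=
      scaledMag_eq_of_toRat_eq (by rw [h, hv0])
    have he : k + 1 ≤ (roundNE φ x).expCode - 1 := by
      apply succ_le_ulpExp_of_le_scaledMag (k := k)
      rw [hS, show φ.manBits + 1 + k = φ.manBits + (k + 1) by ring, pow_add]
      exact Nat.mul_le_mul_right _ htlo
    rw [hS] at hev
    obtain ⟨r, hr⟩ := Nat.exists_eq_add_of_le he
    have h2 : 2 * 2 ^ ((roundNE φ x).expCode - 1) = (2 ^ (k + 1) * 2) * 2 ^ r := by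
      rw [hr]; ring
    have h3 : 2 ^ (k + 1) * 2 ∣ t * 2 ^ (k + 1) := dvd_trans (Dvd.intro _ h2.symm) hev
    rw [mul_comm t] at h3
    have h4 : 2 ∣ t := Nat.dvd_of_mul_dvd_mul_left (by positivity) h3
    obtain ⟨c, hc⟩ := ht
    omega
  · rw [h, hyu]

end Summit.Ventures.CertifiedArithmetic

namespace Summit.Ventures.CertifiedArithmetic.LowPrec.Opt

open Literature.ComputerArithmetic.JeannerodRump2018
open Literature.ComputerArithmetic.JeannerodRump2018.SumTree
open Literature.ComputerArithmetic.FloatingPoint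
open Literature.ComputerArithmetic.FloatingPoint.Format
open Literature.ComputerArithmetic.FloatingPoint.MiniFloat

/-! ## §2 The nine-leaf signed family -/

/-- The tree `τ₉` of shape `((((((·,·),·),((·,·),·)),·),·),·)` on the signed data
`(-4M², -(2M+2), -2M, -4M², -(2M+2), 2M-1, 4M, 4M, 4M)·q` (`M`, `q` rational parameters;
in a format, `M = 2^m` and `q` = one quantum). -/
def signedTree9 (M q : ℚ) : SumTree :=
  .node (.node (.node (.node
      (.node (.node (.leaf (-(4 * M ^ 2 * q))) (.leaf (-((2 * M + 2) * q)))) (.leaf (-(2 * M * q))))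
      (.node (.node (.leaf (-(4 * M ^ 2 * q))) (.leaf (-((2 * M + 2) * q))))
        (.leaf ((2 * M - 1) * q))))
    (.leaf (4 * M * q))) (.leaf (4 * M * q))) (.leaf (4 * M * q))

/-- Exact sum of `τ₉`: `-(8M² - 8M + 5)·q`. -/
theorem exact_signedTree9 (M q : ℚ) : exact (signedTree9 M q) = -(8 * M ^ 2 - 8 * M + 5) * q := by
  simp only [signedTree9, exact]; ring

/-- `Σ|xᵢ|` of `τ₉` for `M ≥ 1`, `q > 0`: `(8M² + 20M + 3)·q`. -/
theorem absLeafSum_signedTree9 {M q : ℚ} (hM : 1 ≤ M) (hq : 0 < q) :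
    absLeafSum (signedTree9 M q) = (8 * M ^ 2 + 20 * M + 3) * q := by
  simp only [signedTree9, absLeafSum]
  have h1 : 0 ≤ 4 * M ^ 2 * q := by positivity
  have h2 : 0 ≤ (2 * M + 2) * q := by nlinarith
  have h3 : 0 ≤ 2 * M * q := by nlinarith
  have h4 : 0 ≤ (2 * M - 1) * q := by nlinarith
  have h5 : 0 ≤ 4 * M * q := by nlinarith
  rw [abs_neg, abs_neg, abs_neg, abs_of_nonneg h1, abs_of_nonneg h2, abs_of_nonneg h3,
    abs_of_nonneg h4, abs_of_nonneg h5]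
  ring

/-- Tree polynomial of `τ₉`: `M_τ₉(u) = 1 + 6u + 2u²` for `0 ≤ u`. -/
theorem treeM_signedTree9 {u : ℚ} (hu0 : 0 ≤ u) (M q : ℚ) :
    treeM u (signedTree9 M q) = 1 + 6 * u + 2 * u ^ 2 := by
  simp only [signedTree9, treeM_node, treeM_leaf]
  have e1 : max (1 + u) 1 = 1 + u := max_eq_left (by linarith)
  have e1' : min (1 + u) 1 = 1 := min_eq_right (by linarith)
  have e0 : max (1 : ℚ) 1 = 1 := max_self 1
  have e0' : min (1 : ℚ) 1 = 1 := min_self 1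
  rw [e0, e0', mul_one, e1, e1', mul_one]
  have e2 : max (1 + u + u) (1 + u + u) = 1 + u + u := max_self _
  have e2' : min (1 + u + u) (1 + u + u) = 1 + u + u := min_self _
  rw [e2, e2']
  have e3 : max (1 + u + u + u * (1 + u + u)) 1 = 1 + u + u + u * (1 + u + u) :=
    max_eq_left (by nlinarith)
  have e3' : min (1 + u + u + u * (1 + u + u)) 1 = 1 := min_eq_right (by nlinarith)
  rw [e3, e3', mul_one]
  have e4 : max (1 + u + u + u * (1 + u + u) + u) 1 = 1 + u + u + u * (1 + u + u) + u :=
    max_eq_left (by nlinarith)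
  have e4' : min (1 + u + u + u * (1 + u + u) + u) 1 = 1 := min_eq_right (by nlinarith)
  rw [e4, e4', mul_one]
  have e5 : max (1 + u + u + u * (1 + u + u) + u + u) 1 = 1 + u + u + u * (1 + u + u) + u + u :=
    max_eq_left (by nlinarith)
  have e5' : min (1 + u + u + u * (1 + u + u) + u + u) 1 = 1 := min_eq_right (by nlinarith)
  rw [e5, e5', mul_one]
  ring

/-! ## §3 The three roundings in a format (`M = 2^m` quanta-significand units) -/

section Format

variable {α : Format}

/-- `flα` is odd: `fl(-y) = -fl(y)`. -/
theorem flα_neg (y : ℚ) : flα α (-y) = -flα α y := by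
  unfold flα; exact toRat_roundNE_neg y

/-- `2 ≤ 2^m` in `ℚ` for `m ≥ 1`. -/
theorem two_le_two_pow_manBits (h1 : 1 ≤ α.manBits) : (2 : ℚ) ≤ (2 : ℚ) ^ α.manBits := by
  calc (2 : ℚ) = 2 ^ 1 := by norm_num
    _ ≤ 2 ^ α.manBits := pow_le_pow_right₀ (by norm_num) h1

/-- ROUNDING E1/E3 (above the midpoint `4M²+2M`): for `0 < δ < 2M·q`,
`fl(-((4M²+2M)q + δ)) = -(4M²+4M)q`. -/
theorem flα_blockHead (hR : 4 * (2 ^ α.manBits) ^ 2 + 4 * 2 ^ α.manBits ≤ α.maxScaled)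
    {δ : ℚ} (hδ0 : 0 < δ) (hδ : δ < 2 * (2 : ℚ) ^ α.manBits * α.quantum) :
    flα α (-(((4 * (2 ^ α.manBits) ^ 2 + 2 * 2 ^ α.manBits : ℕ) : ℚ) * α.quantum + δ))
      = -(((4 * (2 ^ α.manBits) ^ 2 + 4 * 2 ^ α.manBits : ℕ) : ℚ) * α.quantum) := by
  have hmid : (2 * 2 ^ α.manBits + 1) * 2 ^ (α.manBits + 1)
      = 4 * (2 ^ α.manBits) ^ 2 + 2 * 2 ^ α.manBits := by rw [pow_succ]; ring
  have hup : (2 ^ α.manBits + 1) * 2 ^ (α.manBits + 1 + 1)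
      = 4 * (2 ^ α.manBits) ^ 2 + 4 * 2 ^ α.manBits := by rw [pow_succ, pow_succ]; ring
  rw [flα_neg, flα, ← hmid, ← hup]
  congr 1
  apply toRat_roundNE_above_gmid (le_refl _) (Nat.pow_lt_pow_right (by norm_num) (by omega))
    (by rw [hup]; exact hR) hδ0
  calc δ < 2 * (2 : ℚ) ^ α.manBits * α.quantum := hδ
    _ = 2 ^ (α.manBits + 1) * α.quantum := by rw [pow_succ]; ring

/-- ROUNDING E2 (the tie `4M²+6M`, odd lower neighbour `(M+1)·4M`, `m ≥ 1`):
`fl(-(4M²+6M)q) = -(4M²+8M)q`. -/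
theorem flα_blockTie (h1 : 1 ≤ α.manBits)
    (hR : 4 * (2 ^ α.manBits) ^ 2 + 8 * 2 ^ α.manBits ≤ α.maxScaled) :
    flα α (-(((4 * (2 ^ α.manBits) ^ 2 + 6 * 2 ^ α.manBits : ℕ) : ℚ) * α.quantum))
      = -(((4 * (2 ^ α.manBits) ^ 2 + 8 * 2 ^ α.manBits : ℕ) : ℚ) * α.quantum) := by
  have hM2 : 2 ≤ 2 ^ α.manBits :=
    le_trans (by norm_num) (Nat.pow_le_pow_right (by norm_num : 0 < 2) h1)
  have hmid : (2 * (2 ^ α.manBits + 1) + 1) * 2 ^ (α.manBits + 1)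
      = 4 * (2 ^ α.manBits) ^ 2 + 6 * 2 ^ α.manBits := by rw [pow_succ]; ring
  have hup : (2 ^ α.manBits + 1 + 1) * 2 ^ (α.manBits + 1 + 1)
      = 4 * (2 ^ α.manBits) ^ 2 + 8 * 2 ^ α.manBits := by rw [pow_succ, pow_succ]; ring
  rw [flα_neg, flα, ← hmid, ← hup]
  congr 1
  refine toRat_roundNE_gmid_odd h1 ?_ (by omega) (by rw [pow_succ]; omega) (by rw [hup]; exact hR)
  obtain ⟨c, hc⟩ := (dvd_pow_self 2 (by omega : α.manBits ≠ 0) : 2 ∣ 2 ^ α.manBits)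
  exact ⟨c, by omega⟩

/-- ROUNDING E4/E5 (the tie `8M²+12M`, odd lower neighbour `(M+1)·8M`, `m ≥ 1`):
`fl(-(8M²+12M)q) = -(8M²+16M)q`. -/
theorem flα_junctionTie (h1 : 1 ≤ α.manBits)
    (hR : 8 * (2 ^ α.manBits) ^ 2 + 16 * 2 ^ α.manBits ≤ α.maxScaled) :
    flα α (-(((8 * (2 ^ α.manBits) ^ 2 + 12 * 2 ^ α.manBits : ℕ) : ℚ) * α.quantum))
      = -(((8 * (2 ^ α.manBits) ^ 2 + 16 * 2 ^ α.manBits : ℕ) : ℚ) * α.quantum) := by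
  have hM2 : 2 ≤ 2 ^ α.manBits :=
    le_trans (by norm_num) (Nat.pow_le_pow_right (by norm_num : 0 < 2) h1)
  have hmid : (2 * (2 ^ α.manBits + 1) + 1) * 2 ^ (α.manBits + 2)
      = 8 * (2 ^ α.manBits) ^ 2 + 12 * 2 ^ α.manBits := by rw [pow_succ, pow_succ]; ring
  have hup : (2 ^ α.manBits + 1 + 1) * 2 ^ (α.manBits + 2 + 1)
      = 8 * (2 ^ α.manBits) ^ 2 + 16 * 2 ^ α.manBits := by rw [pow_succ, pow_succ, pow_succ]; ring
  rw [flα_neg, flα, ← hmid, ← hup]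
  congr 1
  refine toRat_roundNE_gmid_odd h1 ?_ (by omega) (by rw [pow_succ]; omega) (by rw [hup]; exact hR)
  obtain ⟨c, hc⟩ := (dvd_pow_self 2 (by omega : α.manBits ≠ 0) : 2 ∣ 2 ^ α.manBits)
  exact ⟨c, by omega⟩

/-! ## §4 The five steps in rational form (`M = 2^m` as a rational, `q` = one quantum) -/

/-- E1 — the head of each block: `fl(-4M²q - (2M+2)q) = -(4M²+4M)q`. -/
theorem flα_E1 (h1 : 1 ≤ α.manBits)
    (hR : 8 * (2 ^ α.manBits) ^ 2 + 16 * 2 ^ α.manBits ≤ α.maxScaled) :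
    flα α (-(4 * ((2 ^ α.manBits : ℕ) : ℚ) ^ 2 * α.quantum)
        + -((2 * ((2 ^ α.manBits : ℕ) : ℚ) + 2) * α.quantum))
      = -((4 * ((2 ^ α.manBits : ℕ) : ℚ) ^ 2 + 4 * ((2 ^ α.manBits : ℕ) : ℚ)) * α.quantum) := by
  have hq : 0 < α.quantum := α.quantum_pos
  have h2 := two_le_two_pow_manBits h1
  have hR1 : 4 * (2 ^ α.manBits) ^ 2 + 4 * 2 ^ α.manBits ≤ α.maxScaled := le_trans (by omega) hR
  have harg : -(4 * ((2 ^ α.manBits : ℕ) : ℚ) ^ 2 * α.quantum)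
        + -((2 * ((2 ^ α.manBits : ℕ) : ℚ) + 2) * α.quantum)
      = -(((4 * (2 ^ α.manBits) ^ 2 + 2 * 2 ^ α.manBits : ℕ) : ℚ) * α.quantum
          + 2 * α.quantum) := by
    push_cast; ring
  rw [harg, flα_blockHead hR1 (by positivity) (by nlinarith)]
  push_cast; ring

/-- E2 — block 1's tie: `fl(-(4M²+4M)q - 2Mq) = -(4M²+8M)q`. -/
theorem flα_E2 (h1 : 1 ≤ α.manBits)
    (hR : 8 * (2 ^ α.manBits) ^ 2 + 16 * 2 ^ α.manBits ≤ α.maxScaled) :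
    flα α (-((4 * ((2 ^ α.manBits : ℕ) : ℚ) ^ 2 + 4 * ((2 ^ α.manBits : ℕ) : ℚ)) * α.quantum)
        + -(2 * ((2 ^ α.manBits : ℕ) : ℚ) * α.quantum))
      = -((4 * ((2 ^ α.manBits : ℕ) : ℚ) ^ 2 + 8 * ((2 ^ α.manBits : ℕ) : ℚ)) * α.quantum) := by
  have hR2 : 4 * (2 ^ α.manBits) ^ 2 + 8 * 2 ^ α.manBits ≤ α.maxScaled := le_trans (by omega) hR
  have harg : -((4 * ((2 ^ α.manBits : ℕ) : ℚ) ^ 2 + 4 * ((2 ^ α.manBits : ℕ) : ℚ)) * α.quantum)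
        + -(2 * ((2 ^ α.manBits : ℕ) : ℚ) * α.quantum)
      = -(((4 * (2 ^ α.manBits) ^ 2 + 6 * 2 ^ α.manBits : ℕ) : ℚ) * α.quantum) := by
    push_cast; ring
  rw [harg, flα_blockTie h1 hR2]
  push_cast; ring

/-- E3 — block 2's last step, one quantum above the midpoint:
`fl(-(4M²+4M)q + (2M-1)q) = -(4M²+4M)q`. -/
theorem flα_E3 (h1 : 1 ≤ α.manBits)
    (hR : 8 * (2 ^ α.manBits) ^ 2 + 16 * 2 ^ α.manBits ≤ α.maxScaled) :
    flα α (-((4 * ((2 ^ α.manBits : ℕ) : ℚ) ^ 2 + 4 * ((2 ^ α.manBits : ℕ) : ℚ)) * α.quantum)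
        + (2 * ((2 ^ α.manBits : ℕ) : ℚ) - 1) * α.quantum)
      = -((4 * ((2 ^ α.manBits : ℕ) : ℚ) ^ 2 + 4 * ((2 ^ α.manBits : ℕ) : ℚ)) * α.quantum) := by
  have hq : 0 < α.quantum := α.quantum_pos
  have h2 := two_le_two_pow_manBits h1
  have hR1 : 4 * (2 ^ α.manBits) ^ 2 + 4 * 2 ^ α.manBits ≤ α.maxScaled := le_trans (by omega) hR
  have harg : -((4 * ((2 ^ α.manBits : ℕ) : ℚ) ^ 2 + 4 * ((2 ^ α.manBits : ℕ) : ℚ)) * α.quantum)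
        + (2 * ((2 ^ α.manBits : ℕ) : ℚ) - 1) * α.quantum
      = -(((4 * (2 ^ α.manBits) ^ 2 + 2 * 2 ^ α.manBits : ℕ) : ℚ) * α.quantum + α.quantum) := by
    push_cast; ring
  rw [harg, flα_blockHead hR1 hq (by nlinarith)]
  push_cast; ring

/-- E4 — the junction tie: `fl(-(4M²+8M)q - (4M²+4M)q) = -(8M²+16M)q`. -/
theorem flα_E4 (h1 : 1 ≤ α.manBits)
    (hR : 8 * (2 ^ α.manBits) ^ 2 + 16 * 2 ^ α.manBits ≤ α.maxScaled) :
    flα α (-((4 * ((2 ^ α.manBits : ℕ) : ℚ) ^ 2 + 8 * ((2 ^ α.manBits : ℕ) : ℚ)) * α.quantum)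
        + -((4 * ((2 ^ α.manBits : ℕ) : ℚ) ^ 2 + 4 * ((2 ^ α.manBits : ℕ) : ℚ)) * α.quantum))
      = -((8 * ((2 ^ α.manBits : ℕ) : ℚ) ^ 2 + 16 * ((2 ^ α.manBits : ℕ) : ℚ)) * α.quantum) := by
  have harg : -((4 * ((2 ^ α.manBits : ℕ) : ℚ) ^ 2 + 8 * ((2 ^ α.manBits : ℕ) : ℚ)) * α.quantum)
        + -((4 * ((2 ^ α.manBits : ℕ) : ℚ) ^ 2 + 4 * ((2 ^ α.manBits : ℕ) : ℚ)) * α.quantum)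
      = -(((8 * (2 ^ α.manBits) ^ 2 + 12 * 2 ^ α.manBits : ℕ) : ℚ) * α.quantum) := by
    push_cast; ring
  rw [harg, flα_junctionTie h1 hR]
  push_cast; ring

/-- E5 — the stationary tail tie: `fl(-(8M²+16M)q + 4Mq) = -(8M²+16M)q`. -/
theorem flα_E5 (h1 : 1 ≤ α.manBits)
    (hR : 8 * (2 ^ α.manBits) ^ 2 + 16 * 2 ^ α.manBits ≤ α.maxScaled) :
    flα α (-((8 * ((2 ^ α.manBits : ℕ) : ℚ) ^ 2 + 16 * ((2 ^ α.manBits : ℕ) : ℚ)) * α.quantum)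
        + 4 * ((2 ^ α.manBits : ℕ) : ℚ) * α.quantum)
      = -((8 * ((2 ^ α.manBits : ℕ) : ℚ) ^ 2 + 16 * ((2 ^ α.manBits : ℕ) : ℚ)) * α.quantum) := by
  have harg : -((8 * ((2 ^ α.manBits : ℕ) : ℚ) ^ 2 + 16 * ((2 ^ α.manBits : ℕ) : ℚ)) * α.quantum)
        + 4 * ((2 ^ α.manBits : ℕ) : ℚ) * α.quantum
      = -(((8 * (2 ^ α.manBits) ^ 2 + 12 * 2 ^ α.manBits : ℕ) : ℚ) * α.quantum) := by
    push_cast; ring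
  rw [harg, flα_junctionTie h1 hR]
  push_cast; ring

/-! ## §5 Evaluation and range -/

/-- THE EVALUATION: in every format with `m ≥ 1` and range `8M²+16M ≤ maxScaled`, `τ₉` on the
format's data evaluates IN THE FORMAT to `-(8M²+16M)·q`. -/
theorem eval_signedTree9 (h1 : 1 ≤ α.manBits)
    (hR : 8 * (2 ^ α.manBits) ^ 2 + 16 * 2 ^ α.manBits ≤ α.maxScaled) :
    eval (flα α) (signedTree9 ((2 ^ α.manBits : ℕ) : ℚ) α.quantum)
      = -((8 * ((2 ^ α.manBits : ℕ) : ℚ) ^ 2 + 16 * ((2 ^ α.manBits : ℕ) : ℚ)) * α.quantum) := by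
  simp only [signedTree9, eval]
  rw [flα_E1 h1 hR, flα_E2 h1 hR, flα_E3 h1 hR, flα_E4 h1 hR, flα_E5 h1 hR, flα_E5 h1 hR,
    flα_E5 h1 hR]

/-- Powers of two within range are magnitudes of the format. -/
theorem representable_two_pow (j : ℕ) (hj : 2 ^ j ≤ α.maxScaled) : α.Representable (2 ^ j) :=
  representable_of_pow_dvd (g := j) dvd_rfl (Nat.pow_le_pow_right (by norm_num) (by omega)) hj

/-- THE DATA ARE FORMAT DATA AND EVERY NODE IS IN RANGE (`TreeInRange`), under `m ≥ 1` and
`8M²+16M ≤ maxScaled`. -/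
theorem treeInRange_signedTree9 (h1 : 1 ≤ α.manBits)
    (hR : 8 * (2 ^ α.manBits) ^ 2 + 16 * 2 ^ α.manBits ≤ α.maxScaled) :
    TreeInRange α (signedTree9 ((2 ^ α.manBits : ℕ) : ℚ) α.quantum) := by
  have hq : 0 < α.quantum := α.quantum_pos
  have hM2 : 2 ≤ 2 ^ α.manBits :=
    le_trans (by norm_num) (Nat.pow_le_pow_right (by norm_num : 0 < 2) h1)
  have hmaxRat : ((8 * (2 ^ α.manBits) ^ 2 + 16 * 2 ^ α.manBits : ℕ) : ℚ) * α.quantum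
      ≤ α.maxRat := by
    rw [Format.maxRat]; exact mul_le_mul_of_nonneg_right (by exact_mod_cast hR) hq.le
  -- representability of the five magnitudes
  have h4sq : 4 * (2 ^ α.manBits) ^ 2 = 2 ^ (α.manBits * 2 + 2) := by rw [pow_add, pow_mul]; ring
  have rep_a : α.Representable (4 * (2 ^ α.manBits) ^ 2) := by
    rw [h4sq]; exact representable_two_pow _ (by rw [← h4sq]; omega)
  have rep_b : α.Representable (2 * 2 ^ α.manBits + 2) := by
    refine representable_of_pow_dvd (g := 1) ⟨2 ^ α.manBits + 1, by ring⟩ ?_ (by omega)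
    rw [pow_succ, pow_succ]; omega
  have rep_c : α.Representable (2 * 2 ^ α.manBits) := by
    rw [show 2 * 2 ^ α.manBits = 2 ^ (α.manBits + 1) by rw [pow_succ]; ring]
    exact representable_two_pow _ (by rw [pow_succ]; omega)
  have rep_d : α.Representable (2 * 2 ^ α.manBits - 1) :=
    representable_of_lt_pow (by rw [pow_succ]; omega) (by omega)
  have rep_e : α.Representable (4 * 2 ^ α.manBits) := by
    rw [show 4 * 2 ^ α.manBits = 2 ^ (α.manBits + 2) by rw [pow_add]; ring]
    exact representable_two_pow _ (by rw [pow_add]; omega)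
  -- leaves as values (with signs)
  have leaf_of : ∀ {n : ℕ} (r : ℚ), α.Representable n → r = ((n : ℕ) : ℚ) * α.quantum →
      (∃ y : MiniFloat α, y.toRat = r) ∧ (∃ y : MiniFloat α, y.toRat = -r) := by
    intro n r hn hr
    obtain ⟨y, hy⟩ := exists_toRat_eq_natMul hn
    exact ⟨⟨y, by rw [hy, hr]⟩, ⟨y.flipSign, by rw [toRat_flipSign, hy, hr]⟩⟩
  have la := (leaf_of (4 * ((2 ^ α.manBits : ℕ) : ℚ) ^ 2 * α.quantum) rep_a
    (by push_cast; ring)).2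
  have lb := (leaf_of ((2 * ((2 ^ α.manBits : ℕ) : ℚ) + 2) * α.quantum) rep_b
    (by push_cast; ring)).2
  have lc := (leaf_of (2 * ((2 ^ α.manBits : ℕ) : ℚ) * α.quantum) rep_c (by push_cast; ring)).2
  have ld := (leaf_of ((2 * ((2 ^ α.manBits : ℕ) : ℚ) - 1) * α.quantum) rep_d (by
    rw [Nat.cast_sub (by omega)]; push_cast; ring)).1
  have le := (leaf_of (4 * ((2 ^ α.manBits : ℕ) : ℚ) * α.quantum) rep_e (by push_cast; ring)).1
  -- every node argument has magnitude ≤ (8M²+16M)q ≤ maxRat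
  have bound : ∀ N : ℕ, N ≤ 8 * (2 ^ α.manBits) ^ 2 + 16 * 2 ^ α.manBits →
      |-(((N : ℕ) : ℚ) * α.quantum)| ≤ α.maxRat := by
    intro N hN
    rw [abs_neg, abs_of_nonneg (by positivity)]
    exact le_trans (mul_le_mul_of_nonneg_right (by exact_mod_cast hN) hq.le) hmaxRat
  simp only [signedTree9, TreeInRange, eval]
  rw [flα_E1 h1 hR, flα_E2 h1 hR, flα_E3 h1 hR, flα_E4 h1 hR, flα_E5 h1 hR, flα_E5 h1 hR]
  refine ⟨⟨⟨⟨⟨⟨la, lb, ?_⟩, lc, ?_⟩, ⟨⟨la, lb, ?_⟩, ld, ?_⟩, ?_⟩, le, ?_⟩, le, ?_⟩, le, ?_⟩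
  · rw [show -(4 * ((2 ^ α.manBits : ℕ) : ℚ) ^ 2 * α.quantum)
          + -((2 * ((2 ^ α.manBits : ℕ) : ℚ) + 2) * α.quantum)
        = -(((4 * (2 ^ α.manBits) ^ 2 + 2 * 2 ^ α.manBits + 2 : ℕ) : ℚ) * α.quantum) by
          push_cast; ring]
    exact bound _ (by omega)
  · rw [show -((4 * ((2 ^ α.manBits : ℕ) : ℚ) ^ 2 + 4 * ((2 ^ α.manBits : ℕ) : ℚ)) * α.quantum)
          + -(2 * ((2 ^ α.manBits : ℕ) : ℚ) * α.quantum)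
        = -(((4 * (2 ^ α.manBits) ^ 2 + 6 * 2 ^ α.manBits : ℕ) : ℚ) * α.quantum) by
          push_cast; ring]
    exact bound _ (by omega)
  · rw [show -(4 * ((2 ^ α.manBits : ℕ) : ℚ) ^ 2 * α.quantum)
          + -((2 * ((2 ^ α.manBits : ℕ) : ℚ) + 2) * α.quantum)
        = -(((4 * (2 ^ α.manBits) ^ 2 + 2 * 2 ^ α.manBits + 2 : ℕ) : ℚ) * α.quantum) by
          push_cast; ring]
    exact bound _ (by omega)
  · rw [show -((4 * ((2 ^ α.manBits : ℕ) : ℚ) ^ 2 + 4 * ((2 ^ α.manBits : ℕ) : ℚ)) * α.quantum)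
          + (2 * ((2 ^ α.manBits : ℕ) : ℚ) - 1) * α.quantum
        = -(((4 * (2 ^ α.manBits) ^ 2 + 2 * 2 ^ α.manBits + 1 : ℕ) : ℚ) * α.quantum) by
          push_cast; ring]
    exact bound _ (by omega)
  · rw [show -((4 * ((2 ^ α.manBits : ℕ) : ℚ) ^ 2 + 8 * ((2 ^ α.manBits : ℕ) : ℚ)) * α.quantum)
          + -((4 * ((2 ^ α.manBits : ℕ) : ℚ) ^ 2 + 4 * ((2 ^ α.manBits : ℕ) : ℚ)) * α.quantum)
        = -(((8 * (2 ^ α.manBits) ^ 2 + 12 * 2 ^ α.manBits : ℕ) : ℚ) * α.quantum) by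
          push_cast; ring]
    exact bound _ (by omega)
  all_goals
    rw [show -((8 * ((2 ^ α.manBits : ℕ) : ℚ) ^ 2 + 16 * ((2 ^ α.manBits : ℕ) : ℚ)) * α.quantum)
          + 4 * ((2 ^ α.manBits : ℕ) : ℚ) * α.quantum
        = -(((8 * (2 ^ α.manBits) ^ 2 + 12 * 2 ^ α.manBits : ℕ) : ℚ) * α.quantum) by
          push_cast; ring]
    exact bound _ (by omega)

end Format

end Summit.Ventures.CertifiedArithmetic.LowPrec.Opt
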